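import Literature.Probability.Percolation.CoveringStrictMonotonicityHolds
import Literature.Probability.Percolation.CoveringQuotientMap
import Literature.Probability.Percolation.SubgraphMonotonicity
import HarnessLib

/-!
# The quotient–slab criterion: a sub-structure that meets every orbit of a free tame action at most
# once, with no edge to its own translates, is STRICTLY subcritical at `p_c` of the ambient graph

Builds on p205010 (kernel theorem, internal audit signed; external expert review pending).  Lane
`prim-bschramm` (memo `run/shared/lean/prim/bschramm/P3-NILPOTENT.md` §4.0; LADDER R2c/R3a, VERDICT V19):
the device that plays link (D5) of the `θ(p_c) = 0` chain ("no slab percolates at `p_c(G)`") on every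
rung where a Martineau–Severo quotient is available, abstracted from its two tree instances
(`L/QuotientStrictMonotonicity*.lean`: `ℤ³ → C_n □ ℤ²` ⊇ slab; `TransplantHeisenbergZSlabCritical.lean`:
`H₃(ℤ) × ℤ → (H₃/⟨C^M⟩) × ℤ` ⊇ `S_r`).

**Theorem** (`criticalProb_lt_criticalProb_induce_of_quotient`).  Let `Γ ≠ 1` act freely by automorphisms
on a countable, locally finite, connected, quasi-transitive graph `G` with quasi-transitive quotient
`Γ \ G` and `p_c(G) < 1` (the hypotheses of [MartineauSevero2019, Cor. 2.2], tree theorem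
`MartineauSevero2019_cor22_holds`).  Let `S ⊆ V(G)` be such that (i) `y, g•y ∈ S ⇒ g = 1` and
(ii) `y, z ∈ S`, `y ∼ g•z ⇒ g = 1`.  Then `p_c(G, x) < p_c(G[S], x)` for every `x ∈ S`; in particular
`θ_{G[S]}(x, p_c(G)) = 0` (`theta_induce_criticalProb_eq_zero_of_quotient`).

Proof: by (i) the orbit map is injective on `S`; by (i)+(ii) `G[S]` is EXACTLY the pull-back of the quotient
graph along it (`induce_eq_comap_quotient`); the restriction coupling `theta_comap_le` gives
`θ_{G[S]}(x,p) ≤ θ_{Γ\G}(Γx, p)`, so `p_c(Γ\G) ≤ p_c(G[S])`, and Martineau–Severo gives `p_c(G) < p_c(Γ\G)`.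
Typical use: `Γ = ⟨γ^M⟩` for a central element / a factor translation `γ` and `M` larger than the
`γ`-extent of `S` plus one edge; the quasi-transitivity of the quotient comes from automorphisms commuting
with `Γ` (descent lemma `HeisenbergZ.quotIsoOfEquivariant` in `TransplantHeisenbergZSlabCritical.lean`).
[cite: MartineauSevero2019, Cor. 2.2] [cite: BenjaminiSchramm1996, Thm. 1]
-/

noncomputable section

namespace Summit.CriticalPhenomena.PercolationContinuityZ3.Theorems.QuotientSlab

open MeasureTheory Literature.Probability.Percolation
open Literature.Barriers.CriticalPhenomena (IsQuasiTransitive)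

variable {V : Type} {Γ : Type} [Group Γ] [MulAction Γ V]

/-- (i) ⟹ the orbit map `x ↦ Γx` is injective on `S`. [folklore] -/
theorem orbitMapOn_injective {S : Set V}
    (hS : ∀ (g : Γ) (y : V), y ∈ S → g • y ∈ S → g = 1) :
    Function.Injective (fun x : S => qmk Γ x.1) := by
  intro x y h
  obtain ⟨g, hg⟩ := (qmk_eq_iff Γ x.1 y.1).1 h
  have hgy : g • y.1 ∈ S := by rw [hg]; exact x.2
  have hg1 : g = 1 := hS g y.1 y.2 hgy
  apply Subtype.ext
  rw [← hg, hg1, one_smul]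

/-- (i)+(ii) ⟹ **`G[S]` is the pull-back of the quotient graph along the orbit map** (no adjacency between
points of `S` is created by the quotient). [folklore] -/
theorem induce_eq_comap_quotient {G : SimpleGraph V} (hact : IsActionByAut G Γ) {S : Set V}
    (hS : ∀ (g : Γ) (y : V), y ∈ S → g • y ∈ S → g = 1)
    (hE : ∀ (g : Γ) (y z : V), y ∈ S → z ∈ S → G.Adj y (g • z) → g = 1) :
    G.induce S = (orbitQuotientGraph G Γ).comap (fun x : S => qmk Γ x.1) := by
  ext x y
  rw [SimpleGraph.comap_adj]
  show G.Adj x.1 y.1 ↔ (orbitQuotientGraph G Γ).Adj (qmk Γ x.1) (qmk Γ y.1)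
  rw [quot_adj_iff hact]
  constructor
  · intro h
    refine ⟨fun heq => ?_, ⟨1, by rwa [one_smul]⟩⟩
    have := orbitMapOn_injective (Γ := Γ) hS (a₁ := x) (a₂ := y) heq
    exact h.ne (congrArg Subtype.val this)
  · rintro ⟨-, g, hg⟩
    have hg1 : g = 1 := hE g x.1 y.1 x.2 y.2 hg
    rwa [hg1, one_smul] at hg

/-- `θ_{G[S]}(x,p) ≤ θ_{Γ\G}(Γx, p)` under (i)+(ii). [folklore] -/
theorem theta_induce_le_theta_quotient [Countable V] {G : SimpleGraph V} (hact : IsActionByAut G Γ)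
    {S : Set V} (hS : ∀ (g : Γ) (y : V), y ∈ S → g • y ∈ S → g = 1)
    (hE : ∀ (g : Γ) (y z : V), y ∈ S → z ∈ S → G.Adj y (g • z) → g = 1)
    (x : V) (hx : x ∈ S) (p : unitInterval) :
    theta (G.induce S) ⟨x, hx⟩ p ≤ theta (orbitQuotientGraph G Γ) (qmk Γ x) p := by
  haveI : Countable (MulAction.orbitRel.Quotient Γ V) :=
    inferInstanceAs (Countable (Quotient (MulAction.orbitRel Γ V)))
  rw [induce_eq_comap_quotient hact hS hE]
  exact theta_comap_le (orbitQuotientGraph G Γ) (orbitMapOn_injective hS) ⟨x, hx⟩ p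

/-- **The quotient–slab criterion.**  Under the hypotheses of Martineau–Severo's Cor. 2.2 and (i), (ii):
`p_c(G, x) < p_c(G[S], x)`. [cite: MartineauSevero2019, Cor. 2.2] -/
theorem criticalProb_lt_criticalProb_induce_of_quotient [Countable V] (G : SimpleGraph V)
    [G.LocallyFinite] [Nontrivial Γ] (hact : IsActionByAut G Γ) (hfree : ∀ (g : Γ) (x : V), g • x = x → g = 1)
    (hconn : G.Connected) (hqt : IsQuasiTransitive G) (hqtq : IsQuasiTransitive (orbitQuotientGraph G Γ))
    {S : Set V} (hS : ∀ (g : Γ) (y : V), y ∈ S → g • y ∈ S → g = 1)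
    (hE : ∀ (g : Γ) (y z : V), y ∈ S → z ∈ S → G.Adj y (g • z) → g = 1)
    (x : V) (hx : x ∈ S) (hpc : criticalProb G x < 1) :
    criticalProb G x < criticalProb (G.induce S) ⟨x, hx⟩ :=
  calc criticalProb G x < criticalProb (orbitQuotientGraph G Γ) (qmk Γ x) :=
        MartineauSevero2019_cor22_holds V G Γ inferInstance hact hfree hconn hqt hqtq x hpc
    _ ≤ criticalProb (G.induce S) ⟨x, hx⟩ :=
        criticalProb_le_of_theta_le _ _ _ _ (theta_induce_le_theta_quotient hact hS hE x hx)

/-- … hence **`G[S]` does not percolate at `p_c(G)`** (link (D5) of the Kozma–Nitzan chain for the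
sub-structure `S`). [cite: MartineauSevero2019, Cor. 2.2] -/
theorem theta_induce_criticalProb_eq_zero_of_quotient [Countable V] (G : SimpleGraph V)
    [G.LocallyFinite] [Nontrivial Γ] (hact : IsActionByAut G Γ) (hfree : ∀ (g : Γ) (x : V), g • x = x → g = 1)
    (hconn : G.Connected) (hqt : IsQuasiTransitive G) (hqtq : IsQuasiTransitive (orbitQuotientGraph G Γ))
    {S : Set V} (hS : ∀ (g : Γ) (y : V), y ∈ S → g • y ∈ S → g = 1)
    (hE : ∀ (g : Γ) (y z : V), y ∈ S → z ∈ S → G.Adj y (g • z) → g = 1)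
    (x : V) (hx : x ∈ S) (hpc : criticalProb G x < 1) :
    theta (G.induce S) ⟨x, hx⟩ (criticalProbIOf G x) = 0 :=
  theta_eq_zero_of_lt_criticalProb_holds _ _ _
    (criticalProb_lt_criticalProb_induce_of_quotient G hact hfree hconn hqt hqtq hS hE x hx hpc)

end Summit.CriticalPhenomena.PercolationContinuityZ3.Theorems.QuotientSlab
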